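import Literature.MathematicalPhysics.QuantumFieldTheory.Balaban1983to89.B9Eq326DeltaABlockDecay
import Literature.MathematicalPhysics.QuantumFieldTheory.Balaban1983to89.B9Eq3126QG1QInvPointDecay
import Literature.MathematicalPhysics.QuantumFieldTheory.Balaban1983to89.B9Eq3126H1BlockDecayOfLetters

/-!
# `Balaban1983to89.B9Eq3126H1BlockDecay` — T. Bałaban, *Propagators for lattice gauge theories in a background field*, Commun. Math. Phys. **99** (1985) 389–434
# [Balaban1985BackgroundPropagators] (3.26) p. 395, (3.49) p. 399, (3.126) p. 420, Thm 3.11 p. 416 with [Balaban1985Variational] (45) p. 285, (103) p. 293, (110) p. 294: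
# **THE `L²` DECAY OF THE MINIMIZER's LINEAR RESPONSE `H₁(U) = G₁(U)Q*(QG₁(U)Q*)⁻¹` — THE END OF ROAD ΔA-CT's `H₁` ROW AT ONE STEP:
# `‖P_{y₁} ∘ H₁(U) ∘ r_{y₀}‖ ≤ (4∕γ)e^{r}·C_Q†·(2∕μ₁)e^{r}·K_d(r − r′)²·e^{−r′·d_m(y₀,y₁)}`** for every bond-block family `P`, the coarse-bond point family `r`, every
# `0 ≤ r′ < r`, given — on the SAME displayed letters — the `G₁(U)` block-decay END `B9Eq326DeltaABlockDecay.norm_block_G1ofU_le` (v2; `(4∕γ)e^{r}`), the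
# `(QG₁Q*)⁻¹` point-decay END `B9Eq3126QG1QInvPointDecay.norm_bondPoint_Kinv_le` (`(2∕μ₁)e^{r}`), the `Q†` block-to-point decay letter `C_Q†` (displayed; suppliers
# `B9Eq3126H1BlockDecayOfLetters` §2 ∕ `B9Eq315QLocalLetter` + `B9Eq347LocalLetterAdjoint`), composed by `B9Eq3126H1BlockDecayOfLetters.norm_block_H1ofU_le_of_letters`;
# letters displayed ONCE for both ENDS: `γ` (Thm 3.11), `μ₁` ([B11] (45)'s lower bound of `QG₁Q†`), `p_K`, `β_K`, `‖Q‖ ≤ C_Q`, the conjugated `Q(U)` ∕ `Δ′` ∕ `R(U)`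
# letters uniformly over the fine weights, their coarse companions and the circle, `ρ`, `C_P`, the windows `small`, `small2`

statement-level skeleton of published theorems with citation tags; proofs where landed; nothing here is a claim about the Yang–Mills mass gap

CITATION HEADER (lean-in-tree rule).  Audit cell `pub-balaban`, sub-cell `t4`, BINDER row NE9 (road ΔA-CT of the NE9 formalisation swarm, leaf prover 03
`b2b-balaban-t4-ne9-formalise-leaf-03` gen 76).  Imports this lineage's `B9Eq326DeltaABlockDecay` (v2), `B9Eq3126QG1QInvPointDecay` (v2), `B9Eq3126H1BlockDecayOfLetters`.
Sources READ first-hand: [Balaban1985BackgroundPropagators] p. 399 (3.49) («|H_k(x, y)| ≤ O(1)e^{−δ₀d(x,y)}» is PRINT's claim with print's `δ₀` — NOT asserted: the rate here is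
the radius `r` the displayed windows allow, minus the composition loss `r → r′`), p. 395 (3.26), p. 416 Thm 3.11, p. 420 (3.126); [Balaban1985Variational] p. 285 (45),
p. 293 (103), p. 294 (110).

WHAT IS PROVED (sorry-free; proof lane — no `def`; [folklore] composition BY NAME).
* **`norm_block_H1ofU_le`** — the END above, one line: `norm_block_H1ofU_le_of_letters` at `hG := norm_block_G1ofU_le`, `hK := norm_bondPoint_Kinv_le`, `hQa` displayed.
HONEST SCOPE.  Composition; every analytic letter DISPLAYED (`γ`, `μ₁`, `p_K`, `β_K`, `C_Q`, the conjugated `Q(U)` letters — supplier t4-ne9-p1's `B9Eq349ConjugatedQLetters`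
— `ρ`, `C_P`, `C_Q†`, the windows); the rate loss and `K_d(r − r′)²` are the algebra's price; no number; the refuter desk prices such files CELL-ONLY and so do I; NOT
NE9 (cell pub-balaban: NE9 NOT PRINTED ∕ NOT PROVED; «NE9 ⇐ the named binders»; row WALLED ON A MODEL (O-NE9-1; #5 UNRULED); spine PROVED 0∕9; rung (B)+1 on a finite
T⁴ — NOT infinite volume, NOT mass gap, NOT BetaPertH, NOT Clay; HONEST DEPENDENCY: continuum YM on T⁴ ⇐ BetaPertH ∧ nine spine estimates (0/9 proved); BetaPertH ⇐
(D1) ∧ (D4) ∧ CAP+tail).  NEW file; nothing modified.  Net new unproved facts: 0.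
-/

noncomputable section

open scoped InnerProductSpace ComplexConjugate
open NormedSpace

namespace Literature.MathematicalPhysics.QuantumFieldTheory.Balaban1983to89.B9Eq3126H1BlockDecay

open B4Sect5Torus (TSite tdist)
open B4Sect5Proof (latticeConst)
open B9SectCLatticeCarrier (Bond bpos btgt)
open B9Eq311L2Pairing (WL2)
open B9Eq319QprimeTorus (fineP blockCoord)
open B7Prop1Explicit (U1)
open B11Eq103H1Complex (SiteL2K BondL2K covDivL2K KinvLatticeK)
open B9Eq310HessianOperator (adTransportW PlaqL2K curvOp)
open B9Eq326OperatorAssembly (laplaceAofU RofU G1ofU H1ofU)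
open B9Eq326DeltaABlockDecay (norm_block_G1ofU_le)
open B9Eq3126QG1QInvPointDecay (norm_bondPoint_Kinv_le)
open B9Eq3126H1BlockDecayOfLetters (norm_block_H1ofU_le_of_letters)

variable {d : ℕ} {L : ℕ} [NeZero L] {m : Fin d → ℕ} {𝔸 : Type*} [NormedRing 𝔸] [StarRing 𝔸] [NormedAlgebra ℂ 𝔸] [StarModule ℂ 𝔸] [NormOneClass 𝔸]
  {W : Type*} [NormedAddCommGroup W] [InnerProductSpace ℂ W] [FiniteDimensional ℂ W] (φ : W ≃ₗ[ℂ] 𝔸) {Mφ Mφ' : ℝ}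
  (hφ : ∀ w, ‖φ w‖ ≤ Mφ * ‖w‖) (hφ' : ∀ X, ‖φ.symm X‖ ≤ Mφ' * ‖X‖) (hMφ : 0 ≤ Mφ) (hMφ' : 0 ≤ Mφ')
  {c₀ c₁ : ℝ} [Fact (0 < c₀)] [Fact (0 < c₁)] {η : ℝ} (hη : 0 < η) (hηL : η * L = 1) (U : Bond d (fineP L m) → 𝔸ˣ) (hU : ∀ b, U b ∈ U1 𝔸)
  (hRS : ∀ (b : Bond d (fineP L m)) (v u : W), ⟪adTransportW φ U b v, u⟫_ℂ = ⟪v, adTransportW φ (fun b => (U b)⁻¹) b u⟫_ℂ)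
  (τ : 𝔸 →ₗ[ℂ] ℂ) (Q : BondL2K ℂ d (fineP L m) c₀ W →ₗ[ℂ] BondL2K ℂ d m c₁ W) (a : ℝ)

include hφ hφ' hMφ hMφ' hη hηL hU hRS in
/-- **THE `L²` DECAY OF `H₁(U) = G₁(U)Q*(QG₁(U)Q*)⁻¹` ON THE ONE-STEP TORUS** (diagonal `ηL = 1`): for every background of the letters and every `Q` onto, given the
`γ`-coercivity of `Δ_a` (Thm 3.11), the lower bound `μ₁` of `QG₁Q†` ([B11] (45)), the `Δ′` floor `p_K`, `‖Q‖ ≤ C_Q`, `C_P`, the radius windows, `small`, `small2`, the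
conjugated `Q(U)` ∕ `Δ′` ∕ `R(U)` letters uniformly over the fine weights, their companions and the circle `‖κ‖ = r`, and the `Q†` block-to-point decay letter `C_Q†`
at rate `r` — all DISPLAYED — for every `0 ≤ r′ < r`:
`‖P_{y₁} ∘ H₁(U) ∘ r_{y₀}‖ ≤ (4∕γ)e^{r}·C_Q†·(2∕μ₁)e^{r}·K_d(r − r′)²·e^{−r′·d_m(y₀,y₁)}`.
[cite: Balaban1985BackgroundPropagators, (3.26) p.395, (3.49) p.399, (3.126) p.420, Thm 3.11 p.416; Balaban1985Variational, (45) p.285, (103) p.293, (110) p.294] -/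
theorem norm_block_H1ofU_le (ha : 0 ≤ a) (hm : ∀ i, 1 ≤ m i) (hL : 1 ≤ L)
    (hpos : ∀ x : BondL2K ℂ d (fineP L m) c₀ W, x ≠ 0 → 0 < RCLike.re ⟪x, laplaceAofU L m φ η U τ Q a x⟫_ℂ) (hQs : Function.Surjective Q)
    {γ β βK pK ℓ ℓ' r ρ CP CQ μ₁ : ℝ} (hγ : 0 < γ) (hγ1 : γ ≤ 1) (hβ : 0 ≤ β) (hβ1 : β ≤ 1) (hβK : 0 ≤ βK) (hℓ : 1 ≤ ℓ) (hℓ' : 1 ≤ ℓ') (hr : 0 ≤ r)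
    (hρ : 0 ≤ ρ) (hρ8 : ρ ≤ 1 / 8) (hCP : 0 ≤ CP) (hCQ : 0 ≤ CQ) (hμ₁ : 0 < μ₁)
    (hcoer : ∀ f : BondL2K ℂ d (fineP L m) c₀ W, γ * ‖f‖ ^ 2 ≤ RCLike.re ⟪f, laplaceAofU L m φ η U τ Q a f⟫_ℂ)
    (hX1 : ∀ g : BondL2K ℂ d m c₁ W, μ₁ * ‖g‖ ^ 2 ≤ RCLike.re ⟪g, Q (G1ofU L m φ η U τ hpos (LinearMap.adjoint Q g))⟫_ℂ)
    (hKre : ∀ f : BondL2K ℂ d (fineP L m) c₀ W, -(pK * ‖f‖ ^ 2) ≤ RCLike.re ⟪f, curvOp φ τ η U f⟫_ℂ)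
    (hQ : ∀ f, ‖Q f‖ ≤ CQ * ‖f‖)
    (hwin : r * ℓ * η ≤ 1)
    (hβCC : 4 * r * ℓ * (Mφ * Mφ') * (d * Real.sqrt d) ≤ β) (hβC : 4 * r * ℓ * (Mφ * Mφ') * d ≤ β)
    (hβD : 2 * r * ℓ * (Mφ * Mφ') * Real.sqrt d ≤ β)
    (hQK : ∀ (χ : TSite d (fineP L m) → ℝ) (χ' : TSite d m → ℝ),
      (∀ b : Bond d (fineP L m), |χ (bpos b) - χ (btgt b)| ≤ ℓ * η) →
      (∀ (y : TSite d m), ∀ x ∈ B9Eq319QprimeTorus.blockOf L m y, |χ' y - χ x| ≤ ℓ') →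
      ∀ (MB : BondL2K ℂ d (fineP L m) c₀ W →L[ℂ] BondL2K ℂ d (fineP L m) c₀ W),
      (∀ (g : BondL2K ℂ d (fineP L m) c₀ W) (b : Bond d (fineP L m)),
        WL2.equiv ℂ (fun _ : Bond d (fineP L m) => c₀) W (MB g) b = (χ (bpos b) : ℂ) • WL2.equiv ℂ (fun _ : Bond d (fineP L m) => c₀) W g b) →
      ∀ (MS : SiteL2K ℂ d (fineP L m) c₀ W →L[ℂ] SiteL2K ℂ d (fineP L m) c₀ W),
      (∀ (g : SiteL2K ℂ d (fineP L m) c₀ W) (x : TSite d (fineP L m)),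
        WL2.equiv ℂ (fun _ : TSite d (fineP L m) => c₀) W (MS g) x = (χ x : ℂ) • WL2.equiv ℂ (fun _ : TSite d (fineP L m) => c₀) W g x) →
      ∀ (MF : BondL2K ℂ d m c₁ W →L[ℂ] BondL2K ℂ d m c₁ W),
      (∀ (g : BondL2K ℂ d m c₁ W) (b' : Bond d m),
        WL2.equiv ℂ (fun _ : Bond d m => c₁) W (MF g) b' = (χ' (bpos b') : ℂ) • WL2.equiv ℂ (fun _ : Bond d m => c₁) W g b') →
      ∀ κ : ℂ, ‖κ‖ = r →
      (∀ f, ‖exp (κ • MF) (Q (exp (κ • (-MB)) f)) - Q f‖ ≤ β * ‖f‖) ∧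
      (∀ g, ‖exp (κ • MB) (LinearMap.adjoint Q (exp (κ • (-MF)) g)) - LinearMap.adjoint Q g‖ ≤ β * ‖g‖) ∧
      (∀ f, ‖exp (κ • MB) (curvOp φ τ η U (exp (κ • (-MB)) f)) - curvOp φ τ η U f‖ ≤ βK * ‖f‖) ∧
      (∀ s, ‖exp (κ • MS) (RofU L m φ η U (c₀ := c₀) (exp (κ • (-MS)) s)) - RofU L m φ η U (c₀ := c₀) s‖ ≤ ρ * ‖s‖))
    (hP : ∀ f, ‖covDivL2K ℂ c₀ ((η : ℂ))⁻¹ (adTransportW φ fun b => (U b)⁻¹) f -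
      RofU L m φ η U (c₀ := c₀) (covDivL2K ℂ c₀ ((η : ℂ))⁻¹ (adTransportW φ fun b => (U b)⁻¹) f)‖ ≤ CP * ‖f‖)
    (small : pK / 2 + (21 + 3 * a) * β ^ 2 + 4 * β * CP + 2 * ρ * CP ^ 2 + βK ≤ γ / 4)
    (small2 : β * (4 / γ) * (2 * CQ + 1) + CQ * (CQ + 1) *
        (β * (4 / γ * (2 * (8 / γ) + (8 / γ + 4 / γ) + 2 * ((8 / γ + 4 / γ * CP) + 4 / γ) + a * CQ * (4 / γ) + a * (CQ + 1) * (4 / γ))) +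
          ρ * ((8 / γ + 4 / γ * CP) * ((8 / γ + 4 / γ * CP) + 4 / γ)) + βK * (4 / γ) ^ 2) ≤ μ₁ / 2)
    (PB : TSite d m → BondL2K ℂ d (fineP L m) c₀ W →L[ℂ] BondL2K ℂ d (fineP L m) c₀ W)
    (hPB : ∀ (y : TSite d m) (f : BondL2K ℂ d (fineP L m) c₀ W) (b : Bond d (fineP L m)),
      WL2.equiv ℂ (fun _ : Bond d (fineP L m) => c₀) W (PB y f) b =
        if blockCoord L m (bpos b) = y then WL2.equiv ℂ (fun _ : Bond d (fineP L m) => c₀) W f b else 0)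
    {rF : TSite d m → BondL2K ℂ d m c₁ W →L[ℂ] BondL2K ℂ d m c₁ W}
    (hrF : ∀ (y : TSite d m) (g : BondL2K ℂ d m c₁ W) (b' : Bond d m),
      WL2.equiv ℂ (fun _ : Bond d m => c₁) W (rF y g) b' = if bpos b' = y then WL2.equiv ℂ (fun _ : Bond d m => c₁) W g b' else 0)
    {CQa r' : ℝ} (hCQa : 0 ≤ CQa) (hr' : 0 ≤ r') (hr'r : r' < r)
    (hQa : ∀ z z', ‖PB z' ∘L LinearMap.toContinuousLinearMap (LinearMap.adjoint Q) ∘L rF z‖ ≤ CQa * Real.exp (-(r * tdist m z z')))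
    (y₀ y₁ : TSite d m) :
    ‖PB y₁ ∘L LinearMap.toContinuousLinearMap (H1ofU L m φ η U τ hpos hQs) ∘L rF y₀‖ ≤
      (4 / γ * Real.exp r) * CQa * (2 / μ₁ * Real.exp r) * latticeConst d (r - r') ^ 2 * Real.exp (-(r' * tdist m y₀ y₁)) :=
  norm_block_H1ofU_le_of_letters φ η U τ hpos hQs hPB hrF hm (by positivity) hCQa (by positivity) hr' hr'r
    (fun z y => norm_block_G1ofU_le φ hφ hφ' hMφ hMφ' hη hηL U hU hRS τ Q a ha hm hL hpos hγ hβ hℓ hℓ' hr hρ hρ8 hCP hcoer hKre hwin hβCC hβC hβD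
      hQK hP small PB hPB z y)
    hQa
    (fun y z => norm_bondPoint_Kinv_le φ hφ hφ' hMφ hMφ' hη hηL U hU hRS τ Q a ha hm hL hpos hQs hγ hγ1 hβ hβ1 hβK hℓ hℓ' hr hρ hρ8 hCP hCQ hμ₁ hcoer hX1
      hKre hQ hwin hβCC hβC hβD hQK hP small small2 hrF y z)
    y₀ y₁

end Literature.MathematicalPhysics.QuantumFieldTheory.Balaban1983to89.B9Eq3126H1BlockDecay

end
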